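import Summits.BirchSwinnertonDyer.BirchSwinnertonDyer.Theorems.ManinLocalTwoThreeTwoTorsionLegendreNormalForm
import Literature.NumberTheory.EllipticCurves.TwoDescent
import HarnessLib

/-!
# The index-`4` world meets the tree's COMPLETE `2`-DESCENT: `W₀.toAffine.SplitTwoTorsion x₁ x₂ x₃` (modulo F★ ∧ CES)
(route `ManinLocalTwoThree`, crux C2 `ManinOddAtFour` stmt-BirchSwinnertonDyer-22967; cell bsd-f2-manin, prover p2 gen 21; node for the Lean proof of E-es-185
`IndexFourForcesFreyTwistShape`, es g38 MEMO-es §59.5 STEP 1 («`δ` is injective on `E₀(ℚ)/2E₀(ℚ)`», «`V_tors = δ(T)` has order 4»);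
`--supports stmt-BirchSwinnertonDyer-22967`)

es's STEP 1–3 run the complete `2`-descent `δ : E₀(ℚ)/2E₀(ℚ) ↪ (ℚˣ/ℚˣ²)²` on the curve with full rational `2`-torsion.  The tree HAS this descent for a
general Weierstrass equation (`Literature/…/TwoDescent.lean`: `WeierstrassCurve.Affine.Point.twoDescentMap`, a homomorphism with kernel EXACTLY `2E(F)`,
`ker_twoDescentMap`; Silverman AEC X.1.4), under the hypothesis `WeierstrassCurve.Affine.SplitTwoTorsion W e₁ e₂ e₃` (`b₂ = −4Σeᵢ`, `b₄ = 2Σeᵢeⱼ`,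
`b₆ = −4∏eᵢ`).  This file supplies that hypothesis:

* `splitTwoTorsion_of_three_twoTorsionX` — three pairwise distinct Greenberg rational `2`-torsion abscissae give `SplitTwoTorsion W x₁ x₂ x₃`
  (Vieta, `TwoTorsionNormalForm.b₂_b₄_b₆_of_three_roots`, p2 g21);
* **`exists_splitTwoTorsion_of_index_four`** — in the index-`4` configuration of a lattice-optimal `X₀(N)`-datum of a globally minimal `W₀` (`4 ∣ N`), modulo the
  printed facts F★ ∧ CES: `∃ x₁ x₂ x₃`, pairwise distinct, with `W₀.toAffine.SplitTwoTorsion x₁ x₂ x₃` — so `twoDescentMap` / `ker_twoDescentMap` apply to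
  `W₀` ITSELF (E-an-152d, p2 g21 `IndexFourTwoTorsion.indexFourForcesFullRationalTwoTorsion_of_cuspRational_CES`).

HONEST FRAMING.  Conditional on the statement-only printed facts F★ (`optimalGamma1Parametrization_cusp_rational`) and CES (`exists_optimal_gamma1ParametrizationData`);
E-es-185's remaining input is THEOREM K (Galois action on the cusps of `X₁(N)`, Stevens 1982 Thm. 1.3.1(b)) — not in the tree.  Nothing here proves E-es-185, C2,
Manin's conjecture or BSD.  No definitions, no sorry.
[cite: SilvermanAEC2009, Prop. X.1.4] [cite: GreenbergLNM1716, Prop. 5.14] [cite: ConradEdixhovenStein2003, §6.1.2 and §6.2] [cite: Stevens1989, §2]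
-/

set_option autoImplicit false
-- lint-debt: the directory name repeats the summit name (sibling precedent `ManinLocalTwoThreeTwoTorsionLegendreNormalForm.lean`)
set_option linter.dupNamespace false

noncomputable section

open WeierstrassCurve Literature.NumberTheory.EllipticCurves Literature.NumberTheory.EllipticCurves.ModularForms
open Literature.NumberTheory.EllipticCurves.Greenberg1999

namespace Summit.BirchSwinnertonDyer.BirchSwinnertonDyer.Theorems.ManinLocalTwoThree.TwoTorsionNormalForm

/-- **Three rational `2`-torsion abscissae split the `2`-torsion** in the sense of the tree's complete `2`-descent (`SplitTwoTorsion`: `b₂ = −4Σxᵢ`,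
`b₄ = 2Σxᵢxⱼ`, `b₆ = −4x₁x₂x₃`). [cite: SilvermanAEC2009, Prop. X.1.4] [cite: GreenbergLNM1716, Prop. 5.14] -/
theorem splitTwoTorsion_of_three_twoTorsionX {W : WeierstrassCurve ℚ} {x₁ x₂ x₃ : ℚ} (h12 : x₁ ≠ x₂) (h13 : x₁ ≠ x₃) (h23 : x₂ ≠ x₃)
    (h₁ : HasRationalTwoTorsionX W x₁) (h₂ : HasRationalTwoTorsionX W x₂) (h₃ : HasRationalTwoTorsionX W x₃) :
    W.toAffine.SplitTwoTorsion x₁ x₂ x₃ := by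
  obtain ⟨y₁, e₁, t₁⟩ := h₁
  obtain ⟨y₂, e₂, t₂⟩ := h₂
  obtain ⟨y₃, e₃, t₃⟩ := h₃
  obtain ⟨hb₂, hb₄, hb₆⟩ := b₂_b₄_b₆_of_three_roots (fourXCubed_add_eq_zero_of_twoTorsion e₁ t₁)
    (fourXCubed_add_eq_zero_of_twoTorsion e₂ t₂) (fourXCubed_add_eq_zero_of_twoTorsion e₃ t₃) h12 h13 h23
  exact ⟨hb₂, by linear_combination hb₄ / 2, hb₆⟩

/-- **Index `4` ⟹ the complete `2`-descent applies to `W₀` itself** (modulo F★ ∧ CES): three pairwise distinct rationals `x₁, x₂, x₃` with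
`W₀.toAffine.SplitTwoTorsion x₁ x₂ x₃`, so that `WeierstrassCurve.Affine.Point.twoDescentMap` is an injective-mod-`2E₀(ℚ)` homomorphism on `W₀(ℚ)`
(`ker_twoDescentMap`).  CONDITIONAL on the printed facts; E-es-185 is not proved by this.
[cite: ConradEdixhovenStein2003, §6.1.2, §6.2 and Lemma 6.1.6] [cite: Stevens1989, §2] [cite: SilvermanAEC2009, Prop. X.1.4] -/
theorem exists_splitTwoTorsion_of_index_four (hF : optimalGamma1Parametrization_cusp_rational) (hCES : exists_optimal_gamma1ParametrizationData)
    (W₀ : WeierstrassCurve ℚ) [W₀.IsElliptic] [W₀.IsGloballyMinimal] {N : ℕ} [NeZero N] (D₀ : ModularParametrizationData W₀ N)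
    (hopt : ∀ z ∈ D₀.L.lattice, ∃ w ∈ periodLattice D₀.f, z = D₀.c * w) (h4 : 2 ^ 2 ∣ N)
    (hidx : ∀ z : ℂ, z ∈ periodLatticeGamma1 D₀.f ↔ ∃ w ∈ periodLattice D₀.f, z = 2 * w) :
    ∃ x₁ x₂ x₃ : ℚ, x₁ ≠ x₂ ∧ x₁ ≠ x₃ ∧ x₂ ≠ x₃ ∧ HasRationalTwoTorsionX W₀ x₁ ∧ HasRationalTwoTorsionX W₀ x₂ ∧ HasRationalTwoTorsionX W₀ x₃ ∧
      W₀.toAffine.SplitTwoTorsion x₁ x₂ x₃ := by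
  obtain ⟨x₁, x₂, x₃, h12, h13, h23, h₁, h₂, h₃⟩ :=
    IndexFourTwoTorsion.indexFourForcesFullRationalTwoTorsion_of_cuspRational_CES hF hCES W₀ D₀ hopt h4 hidx
  exact ⟨x₁, x₂, x₃, h12, h13, h23, h₁, h₂, h₃, splitTwoTorsion_of_three_twoTorsionX h12 h13 h23 h₁ h₂ h₃⟩

end Summit.BirchSwinnertonDyer.BirchSwinnertonDyer.Theorems.ManinLocalTwoThree.TwoTorsionNormalForm

end
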